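import Summits.HubbardSuperconductivity.HubbardSuperconductivity.Theorems.BalabanIRBirComplexStableXYRFluctuationSmallField
import Literature.Probability.LatticeModels.LocalPerturbationGaussian
import Literature.Probability.LatticeModels.LocalPerturbationPositivity
import HarnessLib

/-!
# Crux `BirComplexStableXYR` (stmt-HubbardSuperconductivity-14845): the scale-`N` fluctuation field
# of the reference covariance is a finite-range dependent reference — polymer expansions of local
# perturbations are volume-uniform

Support file (prover seat 1, route BalabanIR), on top of `…FluctuationSmallField.lean` (the centred
Gaussian fluctuation field `ζ_N ~ N(0, t·C^{(m)}_N)` of the smooth finite-range pieces of the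
Hessian of `Q_c`) and the tree's local-perturbation polymer gas
(`Literature/Probability/LatticeModels/LocalPerturbation{PolymerGas,Positivity,Gaussian}.lean`).

In every renormalisation-group step of the blueprint (`Lines/log-concave-core-bounded-phase.md`
M2–M4) the integral over the scale-`N` fluctuation field of a product of block-local factors
`∏_B (1 + g_B(ζ_N))` has to be re-expanded as a polymer gas, uniformly in the volume; the ONLY
property of `ζ_N` this uses is the finite-range property — blocks farther apart than the range
`ρ_N = 2m·2^N·3(r−1)` of `C^{(m)}_N` carry independent fields.  This file PROVES it for the engine:

* **`birHessian_fluctuation_polymerGas`** (registered stub of this seat on the crux item): for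
  every admissible table, `L, M`, `m, N`, `t ≥ 0`, EVERY family of blocks `verts : V → Finset Λ`
  and every adjacency `R` on blocks relating distinct blocks at torus-`ℓ¹` distance `≤ ρ_N`, every
  family of block-measurable cell factors `g_B` with `‖g_B‖ ≤ ε` is an `IsLocalPerturbation` of the
  law `N(0, t·C^{(m)}_N)` (Mathlib's `multivariateGaussian`), i.e. satisfies the hypotheses of the
  tree's polymer expansion;
* `birHessian_fluctuation_pertZ_ne_zero`: consequently, if every block has at most `Δ` neighbours
  and `e ε (Δ+1)² ≤ 1/2`, the perturbed partition functions `∫ ∏_{B ∈ C} (1 + g_B) dN(0,t C^{(m)}_N)`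
  are zero-free with the volume-uniform exclusion cost `‖Z(C ∖ D)/Z(C)‖ ≤ exp(2eε(Δ+1)#D)`, and are
  real `> 0` when the activities are real (tree `pertZ_ne_zero`, `norm_pertZ_sdiff_div_le`,
  `pertZ_re_pos_of_im_cellActivity_eq_zero`).

No definitions; sorry-free. [folklore]
-/

noncomputable section

namespace Summit.HubbardSuperconductivity.HubbardSuperconductivity.Theorems

set_option linter.dupNamespace false -- summit = problem name (single-conjunct summit), D-0017

open scoped BigOperators Matrix ComplexConjugate
open Complex Summit.HubbardSuperconductivity.BirComplexStableXYNegative MeasureTheory ProbabilityTheory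
open Literature.Probability.LatticeModels Literature.Analysis.Matrix Literature.Analysis.Fourier

section FluctuationPolymerGas

variable {r : ℕ} {L M : ℕ} [NeZero L] [NeZero M]

-- The window linear form `a_{(s,n)}(j) = Σ_w n_w [sh s w = j]` (local abbreviation).
set_option quotPrecheck false in
local notation "aform[" L' "," M' "](" s "," n "," j ")" =>
  ∑ w, (((n w : ℤ) : ℝ) * (if sh L' M' s w = j then (1 : ℝ) else 0))

-- The inline Hessian matrix of `Q_c` (local abbreviation).
set_option quotPrecheck false in
local notation "Hm[" c' "," L' "," M' "]" => (Matrix.of fun i j : Λ L' M' =>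
  (-(∑ k : Λ L' M' × ↥((c' : Table _).support),
    (c' : Table _) k.2 * ((aform[L',M'](k.1, k.2.1, i) : ℝ) : ℂ)
      * ((aform[L',M'](k.1, k.2.1, j) : ℝ) : ℂ))).re)

-- the torus `ℓ¹` distance (local abbreviation; inline in statements)
set_option quotPrecheck false in
local notation "tdist[" L' "," M' "]" => (fun i j : Λ L' M' =>
  ((j.1 0 - i.1 0).valMinAbs.natAbs + (j.1 1 - i.1 1).valMinAbs.natAbs + (j.2 - i.2).valMinAbs.natAbs))

/-- **The scale-`N` fluctuation field is a finite-range dependent reference (registered stub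
`birHessian_fluctuation_polymerGas` of prover seat 1 on crux 2R).** For every admissible table and
`t ≥ 0`, every family of blocks `verts` with an adjacency `R` relating distinct blocks at torus
distance `≤ ρ_N = 2m·2^N·3(r−1)`, and every family of block-measurable cell factors bounded by
`ε ≥ 0`, the law `N(0, t·C^{(m)}_N)` and the factors form an `IsLocalPerturbation`. [folklore] -/
theorem birHessian_fluctuation_polymerGas : ∀ (r : ℕ) (c : Table r) (c₀ : ℝ), 2 ≤ r → 0 < c₀ → c.sum (fun _ a => a) = 0 → (∀ φ : W r → ℝ, c₀ * ∑ w, ∑ w', (1 - Real.cos (φ w - φ w')) ≤ (genF c φ).re) → ∀ (L M : ℕ) [NeZero L] [NeZero M] (m N : ℕ) (t : ℝ), 0 ≤ t → ∀ (V : Type) [DecidableEq V] (verts : V → Finset (Λ L M)) (R : V → V → Prop), (∀ p q : V, p ≠ q → ∀ a ∈ verts p, ∀ b ∈ verts q, (fun i j : Λ L M => ((j.1 0 - i.1 0).valMinAbs.natAbs + (j.1 1 - i.1 1).valMinAbs.natAbs + (j.2 - i.2).valMinAbs.natAbs)) a b ≤ 2 * m * 2 ^ N * (3 * (r - 1)) →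 R p q) → ∀ (g : V → EuclideanSpace ℝ (Λ L M) → ℂ) (ε : ℝ), 0 ≤ ε → (∀ p : V, Measurable[⨆ a ∈ verts p, MeasurableSpace.comap (fun z : EuclideanSpace ℝ (Λ L M) => z a) inferInstance] (g p)) → (∀ (p : V) (z : EuclideanSpace ℝ (Λ L M)), ‖g p z‖ ≤ ε) → Literature.Probability.LatticeModels.IsLocalPerturbation (ProbabilityTheory.multivariateGaussian 0 (t • Literature.Analysis.Matrix.frdPiecePow ((4 / (2 * normA c * (r : ℝ) ^ 3)) • (Matrix.of fun i j : Λ L M => (-(∑ k : Λ L M × ↥c.support, c k.2 * ((∑ w, ((k.2 : Freq r) w : ℝ) * (if sh L M k.1 w = i then (1 : ℝ) else 0) : ℝ) : ℂ) * ((∑ w, ((k.2 : Freq r) w : ℝ) * (if sh L M k.1 w = j then (1 : ℝ) else 0) : ℝ) : ℂ))).re)) m N)) R (fun p => ⨆ a ∈ verts p, MeasurableSpace.comap (fun z : EuclideanSpace ℝ (Λ L M) => z a) inferInstance) g ε := by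
  intro r c c₀ hr hc₀ hN hC L M _ _ m N t ht V _ verts R hR g ε hε hg hgε
  have hS : (t • frdPiecePow ((4 / (2 * normA c * (r : ℝ) ^ 3)) • Hm[c,L,M]) m N).PosSemidef :=
    cfrd_smul_frdPiecePow_posSemidef hr c hc₀ hN hC m N ht
  have hfr : HasFiniteRange (tdist[L,M]) (2 * m * 2 ^ N * (3 * (r - 1)))
      (t • frdPiecePow ((4 / (2 * normA c * (r : ℝ) ^ 3)) • Hm[c,L,M]) m N) :=
    (cfrd_hasFiniteRange_frdPiecePow c _ m N).smul t
  exact IsLocalPerturbation.multivariateGaussian hS (tdist[L,M]) _ (fun a b hab => hfr a b hab)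
    verts hR hε hg hgε

/-- **Volume-uniform polymer expansion of block-local perturbations of the fluctuation field.**
If moreover `R` is symmetric, every block has at most `Δ` `R`-neighbours (listed by `nbr`) and
`e ε (Δ+1)² ≤ 1/2`, then for every finite family `C` of blocks the perturbed partition function
`Z(C) = ∫ ∏_{B ∈ C} (1 + g_B) dN(0, t·C^{(m)}_N)` is non-zero, the exclusion cost is volume-uniform,
`‖Z(C ∖ D)/Z(C)‖ ≤ exp(#D (Δ+1) 2eε)`, and `Z(C)` is real and positive when the activities are real.
[folklore] -/
theorem birHessian_fluctuation_pertZ_ne_zero (hr : 2 ≤ r) (c : Table r) {c₀ : ℝ} (hc₀ : 0 < c₀)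
    (hN : c.sum (fun _ a => a) = 0)
    (hC : ∀ φ : W r → ℝ, c₀ * ∑ w, ∑ w', (1 - Real.cos (φ w - φ w')) ≤ (genF c φ).re)
    (m N : ℕ) {t : ℝ} (ht : 0 ≤ t) {V : Type} [DecidableEq V] (verts : V → Finset (Λ L M))
    {R : V → V → Prop} [DecidableRel R] (hRsymm : ∀ p q, R p q → R q p)
    (hR : ∀ p q : V, p ≠ q → ∀ a ∈ verts p, ∀ b ∈ verts q,
      tdist[L,M] a b ≤ 2 * m * 2 ^ N * (3 * (r - 1)) → R p q)
    {nbr : V → Finset V} {Δ : ℕ} (hΔ : ∀ p, (nbr p).card ≤ Δ) (hnbr : ∀ p q, R p q → q ∈ nbr p)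
    {g : V → EuclideanSpace ℝ (Λ L M) → ℂ} {ε : ℝ} (hε : 0 ≤ ε)
    (hg : ∀ p : V, Measurable[⨆ a ∈ verts p,
      MeasurableSpace.comap (fun z : EuclideanSpace ℝ (Λ L M) => z a) inferInstance] (g p))
    (hgε : ∀ (p : V) (z : EuclideanSpace ℝ (Λ L M)), ‖g p z‖ ≤ ε)
    (hsmall : Real.exp 1 * ε * ((Δ : ℝ) + 1) ^ 2 ≤ 1 / 2) (C : Finset V) :
    pertZ (multivariateGaussian 0
        (t • frdPiecePow ((4 / (2 * normA c * (r : ℝ) ^ 3)) • Hm[c,L,M]) m N)) g C ≠ 0 ∧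
    (∀ D : Finset V, ‖pertZ (multivariateGaussian 0
        (t • frdPiecePow ((4 / (2 * normA c * (r : ℝ) ^ 3)) • Hm[c,L,M]) m N)) g (C \ D) /
        pertZ (multivariateGaussian 0
          (t • frdPiecePow ((4 / (2 * normA c * (r : ℝ) ^ 3)) • Hm[c,L,M]) m N)) g C‖ ≤
      Real.exp (D.card * ((Δ : ℝ) + 1) * (2 * (Real.exp 1 * ε)))) ∧
    ((∀ K : Finset V, K ⊆ C → (cellActivity (multivariateGaussian 0
        (t • frdPiecePow ((4 / (2 * normA c * (r : ℝ) ^ 3)) • Hm[c,L,M]) m N)) g K).im = 0) →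
      0 < (pertZ (multivariateGaussian 0
        (t • frdPiecePow ((4 / (2 * normA c * (r : ℝ) ^ 3)) • Hm[c,L,M]) m N)) g C).re) := by
  have h := birHessian_fluctuation_polymerGas r c c₀ hr hc₀ hN hC L M m N t ht V verts R hR g ε hε
    hg hgε
  exact ⟨pertZ_ne_zero hRsymm hΔ hnbr h hsmall C,
    fun D => norm_pertZ_sdiff_div_le hRsymm hΔ hnbr h hsmall C D,
    fun hreal => (pertZ_re_pos_of_im_cellActivity_eq_zero hRsymm hΔ hnbr h hsmall hreal).1⟩

end FluctuationPolymerGas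

end Summit.HubbardSuperconductivity.HubbardSuperconductivity.Theorems

end
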